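import Literature.Geometry.Kaehler.AmbientHolomorphicAtlas
import Literature.Geometry.Kaehler.HolomorphicStraightening
import HarnessLib

/-!
# Regular zero loci of holomorphic equations as compact complex manifolds

Layer `Literature/Geometry/Kaehler`. P. Griffiths, J. Harris, *Principles of Algebraic Geometry*
(1978), Ch. 0 §2 pp. 18–20 (complex submanifolds given locally as `{f₁ = ⋯ = f_k = 0}` with
`rank J(f) = k`); C. Voisin, *Hodge Theory and Complex Algebraic Geometry I* (2002), §2.2.1. The
setting of Serre's / Mumford's induction over hyperplane sections read on the analytification
(J.-P. Serre, *GAGA* (1956) n° 16 Lemme 8; the tree's `exists_transverse_flag`,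
`Literature.AlgebraicGeometry.HodgeTheory.BertiniPencilAnalytic`): on a complex manifold `M` a
family of local holomorphic equations `F_a : M → ℂᵏ` on opens `O_a` covering `M`, with CONSISTENT
zero sets on overlaps (the coordinates of sections of a line bundle in different frames) and onto
differentials along the common zero set `Z`.

* `RegularEquations E M α k` — the data; `locus` (`Z`, closed: `isClosed_locus`);
* `RegularEquations.atlas` — the slice charts of holomorphic straightenings
  (`exists_holStraightening`) form an `AmbientHolAtlas` of `Z` of dimension `d` (`dim E = k + d`),
  whence **the compact complex manifold `(R.atlas hd).Carrier`** (`AmbientHolomorphicAtlas`);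
* `RegularEquations.IsPrefix` — `Q'` consists of the first `k'` equations of `Q` (same opens); then
  `Q.locus ⊆ Q'.locus`, the inclusion of carriers `IsPrefix.incl` is holomorphic, a straightening of
  `Q` describes `Q'.locus` as a coordinate subspace (`mem_locus_iff_of_straightening`), and, for
  `k = k' + 1`, **at every point of `Q.locus` the bigger manifold `Q'.locus` has an
  ambient-holomorphic chart valued in `ℂ × ℂᵈ` whose first coordinate IS the last equation**
  (`IsPrefix.exists_sliceChart_succ`) — the local normal form from which division by that equation
  and the density of its non-zero locus follow (`RegularZeroLocusDivision`).

Everything is proved; the definitions are the structures, `locus`, `sliceChart`, `atlas`,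
`IsPrefix.incl` and the linear maps `snocL`, `embSucc`, `projSucc`.

## References

* P. Griffiths, J. Harris, *Principles of Algebraic Geometry*, Wiley (1978), Ch. 0 §2 pp. 18–20.
  [GriffithsHarris1978]
* C. Voisin, *Hodge Theory and Complex Algebraic Geometry I*, CUP (2002), §2.2.1. [VoisinHodgeI2002]
* J.-P. Serre, *Géométrie algébrique et géométrie analytique*, Ann. Inst. Fourier 6 (1956), n° 16
  Lemme 8. [SerreGAGA1956]
-/

noncomputable section

open scoped Manifold ContDiff Topology
open Set Filter Function Module

namespace Literature.Geometry.Kaehler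

variable {E : Type*} [NormedAddCommGroup E] [NormedSpace ℂ E]
  {M : Type*} [TopologicalSpace M] [ChartedSpace E M]
  {α : Type*} {k k' d d' : ℕ}

/-! ### Local holomorphic equations with consistent zeros and onto differentials -/

variable (E M) in
/-- **Regular local equations of codimension `k`** on the complex manifold `M`: opens `O_a`
covering `M`, holomorphic maps `F_a : O_a → ℂᵏ` whose zero sets agree on overlaps, with onto
differential at every common zero (Griffiths–Harris, Ch. 0 §2: `rank J(f) = k` along
`{f₁ = ⋯ = f_k = 0}`). The intended instance: `F_a = (u_{0,a}, …, u_{k-1,a})`, the coordinates in the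
frame `a` of `k` sections of a holomorphic line bundle meeting transversally.
[cite: GriffithsHarris1978, Ch. 0 §2 pp. 18–20] -/
structure RegularEquations (α : Type*) (k : ℕ) where
  /-- the open sets carrying the local equations -/
  O : α → Set M
  /-- they are open -/
  isOpen_O : ∀ a, IsOpen (O a)
  /-- they cover `M` -/
  cover : ∀ x, ∃ a, x ∈ O a
  /-- the local equations -/
  F : α → M → (Fin k → ℂ)
  /-- the local equations are holomorphic -/
  mdifferentiableOn_F : ∀ a, MDifferentiableOn 𝓘(ℂ, E) 𝓘(ℂ, Fin k → ℂ) (F a) (O a)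
  /-- the zero sets agree on overlaps -/
  zero_iff : ∀ a b x, x ∈ O a → x ∈ O b → (F a x = 0 ↔ F b x = 0)
  /-- the differential is onto at every zero -/
  surjective_mfderiv : ∀ a x, x ∈ O a → F a x = 0 →
    Surjective (mfderiv 𝓘(ℂ, E) 𝓘(ℂ, Fin k → ℂ) (F a) x)

namespace RegularEquations

variable (R : RegularEquations E M α k)

/-- **The regular zero locus `Z = {F = 0}`.** [cite: GriffithsHarris1978, Ch. 0 §2 pp. 18–20] -/
def locus : Set M :=
  {x | ∃ a, x ∈ R.O a ∧ R.F a x = 0}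

/-- Membership in `Z` is tested in any chart containing the point. [folklore] -/
theorem mem_locus_iff {a : α} {x : M} (ha : x ∈ R.O a) : x ∈ R.locus ↔ R.F a x = 0 := by
  refine ⟨?_, fun h ↦ ⟨a, ha, h⟩⟩
  rintro ⟨b, hb, h⟩
  exact (R.zero_iff b a x hb ha).1 h

/-- **`Z` is closed** (locally closed in each `O_a`, which cover `M`). [folklore] -/
theorem isClosed_locus : IsClosed R.locus := by
  rw [← isOpen_compl_iff, isOpen_iff_mem_nhds]
  intro x hx
  obtain ⟨a, ha⟩ := R.cover x
  have hne : R.F a x ≠ 0 := fun h ↦ hx ⟨a, ha, h⟩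
  have hopen : IsOpen (R.O a ∩ R.F a ⁻¹' {0}ᶜ) :=
    (R.mdifferentiableOn_F a).continuousOn.isOpen_inter_preimage (R.isOpen_O a) isOpen_compl_singleton
  refine mem_of_superset (hopen.mem_nhds ⟨ha, hne⟩) ?_
  rintro y ⟨hya, hy⟩ hyZ
  exact hy ((R.mem_locus_iff hya).1 hyZ)

/-! ### Straightening charts and the manifold structure -/

section Manifold

variable [FiniteDimensional ℂ E] [IsManifold 𝓘(ℂ, E) ω M]

/-- **A holomorphic straightening of the equations at a zero**: `e : M ⇀ ℂᵏ × ℂᵈ` with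
`(e y).1 = F_a y`, holomorphic in both directions (`exists_holStraightening`).
[cite: GriffithsHarris1978, Ch. 0 §1 and §2 pp. 18–20] -/
theorem exists_straightening (hd : finrank ℂ E = k + d) {a : α} {z : M} (ha : z ∈ R.O a) (hz : R.F a z = 0) :
    ∃ e : OpenPartialHomeomorph M ((Fin k → ℂ) × (Fin d → ℂ)), z ∈ e.source ∧ e.source ⊆ R.O a ∧
      MDifferentiableOn 𝓘(ℂ, E) 𝓘(ℂ, (Fin k → ℂ) × (Fin d → ℂ)) e e.source ∧
      MDifferentiableOn 𝓘(ℂ, (Fin k → ℂ) × (Fin d → ℂ)) 𝓘(ℂ, E) e.symm e.target ∧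
      ∀ y ∈ e.source, (e y).1 = R.F a y :=
  exists_holStraightening (R.isOpen_O a) ha (R.mdifferentiableOn_F a) (R.surjective_mfderiv a z ha hz) hd

omit [FiniteDimensional ℂ E] [IsManifold 𝓘(ℂ, E) ω M] in
/-- In a straightening of `F_a`, `Z = {(e ·).1 = 0}`: `y ∈ Z ↔ (0, (e y).2) = e y` on the source.
[cite: GriffithsHarris1978, Ch. 0 §2 pp. 18–20] -/
theorem mem_locus_iff_inr_eq {a : α} {e : OpenPartialHomeomorph M ((Fin k → ℂ) × (Fin d → ℂ))}
    (hsub : e.source ⊆ R.O a) (hfst : ∀ y ∈ e.source, (e y).1 = R.F a y) (y : M) (hy : y ∈ e.source) :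
    y ∈ R.locus ↔ (ContinuousLinearMap.inr ℂ (Fin k → ℂ) (Fin d → ℂ))
      ((ContinuousLinearMap.snd ℂ (Fin k → ℂ) (Fin d → ℂ)) (e y)) = e y := by
  rw [R.mem_locus_iff (hsub hy), ← hfst y hy, ContinuousLinearMap.inr_apply, ContinuousLinearMap.coe_snd',
    Prod.ext_iff]
  simp only [and_true]
  exact eq_comm

/-- The chart index at a point of `Z`. [folklore] -/
def idx (z : R.locus) : α :=
  Classical.choose z.2

omit [FiniteDimensional ℂ E] [IsManifold 𝓘(ℂ, E) ω M] in
/-- The point lies in the open set of its chart index, and is a zero there. [folklore] -/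
theorem idx_spec (z : R.locus) : (z : M) ∈ R.O (R.idx z) ∧ R.F (R.idx z) z = 0 :=
  Classical.choose_spec z.2

/-- The chosen straightening at a point of `Z`. [folklore] -/
def straightening (hd : finrank ℂ E = k + d) (z : R.locus) :
    OpenPartialHomeomorph M ((Fin k → ℂ) × (Fin d → ℂ)) :=
  Classical.choose (R.exists_straightening hd (R.idx_spec z).1 (R.idx_spec z).2)

/-- The properties of the chosen straightening. [folklore] -/
theorem straightening_spec (hd : finrank ℂ E = k + d) (z : R.locus) :
    (z : M) ∈ (R.straightening hd z).source ∧ (R.straightening hd z).source ⊆ R.O (R.idx z) ∧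
      MDifferentiableOn 𝓘(ℂ, E) 𝓘(ℂ, (Fin k → ℂ) × (Fin d → ℂ)) (R.straightening hd z)
        (R.straightening hd z).source ∧
      MDifferentiableOn 𝓘(ℂ, (Fin k → ℂ) × (Fin d → ℂ)) 𝓘(ℂ, E) (R.straightening hd z).symm
        (R.straightening hd z).target ∧
      ∀ y ∈ (R.straightening hd z).source, (R.straightening hd z y).1 = R.F (R.idx z) y :=
  Classical.choose_spec (R.exists_straightening hd (R.idx_spec z).1 (R.idx_spec z).2)

/-- **The slice chart of `Z` at a point**: `y ↦ (e y).2` for the chosen straightening `e`.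
[cite: GriffithsHarris1978, Ch. 0 §2 pp. 18–20] -/
def sliceChart (hd : finrank ℂ E = k + d) (z : R.locus) : AmbientHolChart E R.locus (Fin d → ℂ) :=
  AmbientHolChart.ofSlice (R.straightening hd z) (R.straightening_spec hd z).2.2.1
    (R.straightening_spec hd z).2.2.2.1 (ContinuousLinearMap.inr ℂ (Fin k → ℂ) (Fin d → ℂ))
    (ContinuousLinearMap.snd ℂ (Fin k → ℂ) (Fin d → ℂ)) (fun _ ↦ rfl)
    (R.mem_locus_iff_inr_eq (R.straightening_spec hd z).2.1 (R.straightening_spec hd z).2.2.2.2) z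

/-- The source of the slice chart at `z` is `Z ∩ e.source`. [folklore] -/
theorem sliceChart_source (hd : finrank ℂ E = k + d) (z : R.locus) :
    (R.sliceChart hd z).source = Subtype.val ⁻¹' (R.straightening hd z).source :=
  rfl

/-- The point lies in the source of its slice chart. [folklore] -/
theorem mem_sliceChart_source (hd : finrank ℂ E = k + d) (z : R.locus) : z ∈ (R.sliceChart hd z).source :=
  (R.straightening_spec hd z).1

/-- **The atlas of slice charts** of the regular zero locus. [cite: GriffithsHarris1978, Ch. 0 §2 pp. 18–20] -/
def atlas (hd : finrank ℂ E = k + d) : AmbientHolAtlas E R.locus d where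
  chart := R.sliceChart hd
  mem_source := R.mem_sliceChart_source hd

/-- **The regular zero locus of a compact complex manifold is a compact complex manifold.**
[cite: GriffithsHarris1978, Ch. 0 §2 pp. 18–20] -/
theorem compactSpace_carrier [CompactSpace M] (hd : finrank ℂ E = k + d) :
    CompactSpace (R.atlas hd).Carrier :=
  (R.atlas hd).compactSpace R.isClosed_locus

end Manifold

/-! ### Prefixes: the first `k'` equations -/

/-- **`Q'` is the prefix of length `k'` of `Q`**: same open sets, and `F'_a` consists of the first
`k'` components of `F_a` (the partial flags `{u₀ = ⋯ = u_{k'-1} = 0} ⊇ {u₀ = ⋯ = u_{k-1} = 0}` of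
Serre's induction). [cite: SerreGAGA1956, n° 16 Lemme 8] -/
structure IsPrefix (Q' : RegularEquations E M α k') (Q : RegularEquations E M α k) (hk : k' ≤ k) : Prop where
  /-- same open sets -/
  O_eq : ∀ a, Q'.O a = Q.O a
  /-- the first `k'` equations -/
  F_eq : ∀ a x (i : Fin k'), Q'.F a x i = Q.F a x (Fin.castLE hk i)

namespace IsPrefix

variable {Q' : RegularEquations E M α k'} {Q : RegularEquations E M α k} {hk : k' ≤ k}

/-- Every family is a prefix of itself. [folklore] -/
theorem refl (Q : RegularEquations E M α k) : Q.IsPrefix Q le_rfl :=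
  ⟨fun _ ↦ rfl, fun _ _ _ ↦ rfl⟩

/-- Prefixes compose. [folklore] -/
theorem trans {k'' : ℕ} {Q'' : RegularEquations E M α k''} {hk' : k'' ≤ k'} (h' : Q''.IsPrefix Q' hk')
    (h : Q'.IsPrefix Q hk) : Q''.IsPrefix Q (hk'.trans hk) :=
  ⟨fun a ↦ (h'.O_eq a).trans (h.O_eq a), fun a x i ↦ by rw [h'.F_eq, h.F_eq]; rfl⟩

/-- **The zero locus of all the equations lies in that of a prefix.** [folklore] -/
theorem locus_subset (h : Q'.IsPrefix Q hk) : Q.locus ⊆ Q'.locus := by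
  rintro x ⟨a, ha, hx⟩
  refine ⟨a, (h.O_eq a).symm ▸ ha, funext fun i ↦ ?_⟩
  rw [h.F_eq, hx]
  rfl

/-- **In a straightening of `Q` (first component `F_a`), the locus of the prefix is a coordinate
subspace**: `y ∈ Q'.locus ↔` the first `k'` coordinates of `(e y).1` vanish. [cite: GriffithsHarris1978, Ch. 0 §2 pp. 18–20] -/
theorem mem_locus_iff_of_straightening (h : Q'.IsPrefix Q hk) {a : α}
    {e : OpenPartialHomeomorph M ((Fin k → ℂ) × (Fin d → ℂ))} (hsub : e.source ⊆ Q.O a)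
    (hfst : ∀ y ∈ e.source, (e y).1 = Q.F a y) {y : M} (hy : y ∈ e.source) :
    y ∈ Q'.locus ↔ ∀ i : Fin k', (e y).1 (Fin.castLE hk i) = 0 := by
  have hya : y ∈ Q'.O a := (h.O_eq a).symm ▸ hsub hy
  rw [Q'.mem_locus_iff hya, hfst y hy, funext_iff]
  exact forall_congr' fun i ↦ by rw [h.F_eq]; rfl

section Incl

variable [FiniteDimensional ℂ E] [IsManifold 𝓘(ℂ, E) ω M]

/-- **The inclusion of the manifolds `Q.locus → Q'.locus`.** [folklore] -/
def incl (h : Q'.IsPrefix Q hk) (hd : finrank ℂ E = k + d) (hd' : finrank ℂ E = k' + d') :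
    (Q.atlas hd).Carrier → (Q'.atlas hd').Carrier := fun y ↦
  (Q'.atlas hd').ofSubtype ⟨(Q.atlas hd).val y, h.locus_subset ((Q.atlas hd).val_mem y)⟩

/-- The inclusion commutes with the inclusions into `M`. [folklore] -/
@[simp]
theorem val_incl (h : Q'.IsPrefix Q hk) (hd : finrank ℂ E = k + d) (hd' : finrank ℂ E = k' + d')
    (y : (Q.atlas hd).Carrier) : (Q'.atlas hd').val (h.incl hd hd' y) = (Q.atlas hd).val y :=
  rfl

/-- The inclusion is injective. [folklore] -/
theorem incl_injective (h : Q'.IsPrefix Q hk) (hd : finrank ℂ E = k + d) (hd' : finrank ℂ E = k' + d') :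
    Injective (h.incl hd hd') := fun y y' hyy' ↦
  (Q.atlas hd).val_injective (by rw [← h.val_incl hd hd' y, ← h.val_incl hd hd' y', hyy'])

/-- The inclusion is continuous. [folklore] -/
theorem continuous_incl (h : Q'.IsPrefix Q hk) (hd : finrank ℂ E = k + d) (hd' : finrank ℂ E = k' + d') :
    Continuous (h.incl hd hd') :=
  (Q'.atlas hd').isInducing_val.continuous_iff.2 (Q.atlas hd).continuous_val

/-- **The inclusion `Q.locus → Q'.locus` is holomorphic** (its composite with the inclusion into
`M` is). [cite: GriffithsHarris1978, Ch. 0 §2 pp. 18–20] -/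
theorem mdifferentiable_incl (h : Q'.IsPrefix Q hk) (hd : finrank ℂ E = k + d) (hd' : finrank ℂ E = k' + d') :
    MDifferentiable 𝓘(ℂ, Fin d → ℂ) 𝓘(ℂ, Fin d' → ℂ) (h.incl hd hd') := fun y ↦
  (Q'.atlas hd').mdifferentiableAt_of_val_comp ((Q.atlas hd).mdifferentiable_val y)

/-- The image of the inclusion is the set of points of `Q'.locus` lying in `Q.locus`. [folklore] -/
theorem range_incl (h : Q'.IsPrefix Q hk) (hd : finrank ℂ E = k + d) (hd' : finrank ℂ E = k' + d') :
    range (h.incl hd hd') = (Q'.atlas hd').val ⁻¹' Q.locus := by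
  ext y'
  refine ⟨?_, fun hy' ↦ ⟨(Q.atlas hd).ofSubtype ⟨(Q'.atlas hd').val y', hy'⟩, rfl⟩⟩
  rintro ⟨y, rfl⟩
  exact (Q.atlas hd).val_mem y

end Incl

end IsPrefix

/-! ### One more equation: slice charts of `Q'.locus` in which the last equation is a coordinate -/

section Succ

/-- `c ↦ (0, …, 0, c) ∈ ℂ^{k'+1}` as a continuous linear map. [folklore] -/
def snocL (k' : ℕ) : ℂ →L[ℂ] (Fin (k' + 1) → ℂ) :=
  LinearMap.toContinuousLinearMap
    { toFun := fun c ↦ Fin.snoc (0 : Fin k' → ℂ) c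
      map_add' := fun c c' ↦ funext fun i ↦ by
        refine Fin.lastCases ?_ (fun j ↦ ?_) i
        · simp only [Fin.snoc_last, Pi.add_apply]
        · simp only [Fin.snoc_castSucc, Pi.add_apply, Pi.zero_apply, add_zero]
      map_smul' := fun r c ↦ funext fun i ↦ by
        refine Fin.lastCases ?_ (fun j ↦ ?_) i
        · simp only [Fin.snoc_last, Pi.smul_apply, smul_eq_mul, RingHom.id_apply]
        · simp only [Fin.snoc_castSucc, Pi.smul_apply, Pi.zero_apply, smul_zero, RingHom.id_apply] }

/-- `snocL c` at the last index. [folklore] -/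
@[simp]
theorem snocL_apply_last (c : ℂ) : snocL k' c (Fin.last k') = c :=
  Fin.snoc_last (α := fun _ ↦ ℂ) _ _

/-- `snocL c` at the other indices. [folklore] -/
@[simp]
theorem snocL_apply_castSucc (c : ℂ) (i : Fin k') : snocL k' c (Fin.castSucc i) = 0 :=
  Fin.snoc_castSucc (α := fun _ ↦ ℂ) _ _ _

variable (k' d) in
/-- The embedding `ℂ × ℂᵈ → ℂ^{k'+1} × ℂᵈ`, `(c, w) ↦ ((0, …, 0, c), w)`. [folklore] -/
def embSucc : (ℂ × (Fin d → ℂ)) →L[ℂ] ((Fin (k' + 1) → ℂ) × (Fin d → ℂ)) :=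
  (snocL k').prodMap (ContinuousLinearMap.id ℂ (Fin d → ℂ))

variable (k' d) in
/-- The projection `ℂ^{k'+1} × ℂᵈ → ℂ × ℂᵈ`, `(v, w) ↦ (v_{last}, w)`. [folklore] -/
def projSucc : ((Fin (k' + 1) → ℂ) × (Fin d → ℂ)) →L[ℂ] (ℂ × (Fin d → ℂ)) :=
  (ContinuousLinearMap.proj (Fin.last k')).prodMap (ContinuousLinearMap.id ℂ (Fin d → ℂ))

/-- `projSucc ∘ embSucc = id`. [folklore] -/
@[simp]
theorem projSucc_embSucc (w : ℂ × (Fin d → ℂ)) : projSucc k' d (embSucc k' d w) = w := by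
  obtain ⟨c, w⟩ := w
  simp [projSucc, embSucc]

/-- The first component of `projSucc`. [folklore] -/
@[simp]
theorem projSucc_apply_fst (v : (Fin (k' + 1) → ℂ) × (Fin d → ℂ)) : (projSucc k' d v).1 = v.1 (Fin.last k') :=
  rfl

/-- `v` lies in the image of `embSucc` iff its first `k'` coordinates vanish. [folklore] -/
theorem embSucc_projSucc_eq_iff (v : (Fin (k' + 1) → ℂ) × (Fin d → ℂ)) :
    embSucc k' d (projSucc k' d v) = v ↔ ∀ i : Fin k', v.1 (Fin.castSucc i) = 0 := by
  obtain ⟨v, w⟩ := v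
  have h1 : embSucc k' d (projSucc k' d (v, w)) = (snocL k' (v (Fin.last k')), w) := rfl
  rw [h1, Prod.mk.injEq]
  simp only [and_true]
  rw [funext_iff]
  refine ⟨fun h i ↦ ?_, fun h i ↦ ?_⟩
  · have := h (Fin.castSucc i)
    rw [snocL_apply_castSucc] at this
    exact this.symm
  · refine Fin.lastCases ?_ (fun j ↦ ?_) i
    · rw [snocL_apply_last]
    · rw [snocL_apply_castSucc, h j]

variable {Q' : RegularEquations E M α k'} {Q : RegularEquations E M α (k' + 1)}

/-- In a straightening of `Q`, the locus of the prefix `Q'` of length `k'` is straightened along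
`embSucc`. [cite: GriffithsHarris1978, Ch. 0 §2 pp. 18–20] -/
theorem IsPrefix.mem_locus_iff_embSucc (h : Q'.IsPrefix Q (Nat.le_succ k')) {a : α}
    {e : OpenPartialHomeomorph M ((Fin (k' + 1) → ℂ) × (Fin d → ℂ))} (hsub : e.source ⊆ Q.O a)
    (hfst : ∀ y ∈ e.source, (e y).1 = Q.F a y) (y : M) (hy : y ∈ e.source) :
    y ∈ Q'.locus ↔ embSucc k' d (projSucc k' d (e y)) = e y := by
  rw [h.mem_locus_iff_of_straightening hsub hfst hy, embSucc_projSucc_eq_iff]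
  exact forall_congr' fun i ↦ by rfl

variable [FiniteDimensional ℂ E] [IsManifold 𝓘(ℂ, E) ω M] in
/-- **The slice chart of the bigger locus adapted to the last equation.** If `Q'` is the prefix of
length `k'` of `Q` (`k = k' + 1`) and `z` is a zero of `Q` in the chart `a`, then `Q'.locus` has an
ambient-holomorphic chart `σ` around `z`, valued in `ℂ × ℂᵈ`, whose source lies over `O_a` and whose
FIRST COORDINATE IS THE LAST EQUATION: `(σ y).1 = (F_a y)_{k'}` (Griffiths–Harris, Ch. 0 §2: complete
`f_k` to local coordinates on `{f₁ = ⋯ = f_{k-1} = 0}`). [cite: GriffithsHarris1978, Ch. 0 §2 pp. 18–20] -/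
theorem IsPrefix.exists_sliceChart_succ (h : Q'.IsPrefix Q (Nat.le_succ k')) (hd : finrank ℂ E = (k' + 1) + d)
    {a : α} {z : M} (hza : z ∈ Q.O a) (hz : Q.F a z = 0) :
    ∃ σ : AmbientHolChart E Q'.locus (ℂ × (Fin d → ℂ)),
      (⟨z, h.locus_subset ⟨a, hza, hz⟩⟩ : Q'.locus) ∈ σ.source ∧
      (∀ y ∈ σ.source, (y : M) ∈ Q.O a) ∧
      ∀ y ∈ σ.source, (σ.toOpenPartialHomeomorph y).1 = Q.F a y (Fin.last k') := by
  obtain ⟨e, hze, hsub, he, hesymm, hfst⟩ := Q.exists_straightening hd hza hz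
  refine ⟨AmbientHolChart.ofSlice e he hesymm (embSucc k' d) (projSucc k' d) projSucc_embSucc
    (h.mem_locus_iff_embSucc hsub hfst) ⟨z, h.locus_subset ⟨a, hza, hz⟩⟩, hze,
    fun y hy ↦ hsub hy, fun y hy ↦ ?_⟩
  rw [AmbientHolChart.ofSlice_apply, projSucc_apply_fst, hfst _ hy]

end Succ

end RegularEquations

end Literature.Geometry.Kaehler
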